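import Mathlib
import Summits.ValiantsHypothesis.ValiantsHypothesis.Theorems.LiouvilleSarnakLiouvilleCutRankOneBlock

/-!
# Route LiouvilleSarnak — crux `LiouvilleCutRank` (stmt-ValiantsHypothesis-14775): COMPLETE MULTIPLICATIVITY IS
# NOT ENOUGH (a second barrier lemma: a character-like twin of `λ` with bounded aligned cut rank)

`Theorems/LiouvilleSarnakLiouvilleCutRankDyadicBarrier.lean` showed that the dyadic identity `λ(2x) = -λ(x)` alone
carries no cut-rank information.  This file goes further in the multiplicative direction: there is a COMPLETELY
MULTIPLICATIVE `f : ℕ → {±1}` with `f(2) = f(3) = f(7) = -1`, indeed `f(m) = -1` for EVERY `m ≡ 3 (mod 4)` (so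
`f(p) = λ(p)` for all primes `p ≡ 3 (mod 4)` and for `p = 2`), whose ALIGNED cut matrices
`(f(a + 2^n b + 1))_{a,b<2^n}` have rank `≤ 4` for every `n ≥ 2` — whereas for `λ` these ranks are unbounded
(`AlignedCutRank`, proved from Coons' non-automaticity) and `LiouvilleCutRank` asks the same of every balanced cut.
The witness is the `2`-adically twisted character `f(2^v m') = (-1)^v χ₄(m')` (`m'` odd), a `2`-AUTOMATIC completely
multiplicative function: a row `a` of the aligned matrix is constant unless `2^{n-1} ∣ a + 1`.

* `exists_completelyMultiplicative_alignedRank_le_four` — ★ the barrier statement.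

Consequence for planning (honest framing): any proof of the crux — already of its aligned rung — must use information
separating `λ` from the completely multiplicative AUTOMATIC functions (twisted Dirichlet characters of `2`-power
conductor), e.g. `λ(p) = -1` at the primes `p ≡ 1 (mod 4)` / non-pretentiousness / non-automaticity; complete
multiplicativity plus any amount of information at `p = 2` and at the primes `≡ 3 (mod 4)` is insufficient.  Nothing
here is a case of the crux; `LiouvilleCutRank`, `DigitalBilinearLiouville`, `AlgebraicSarnak` stay OPEN; nothing bears
on `VP ≠ VNP`.  No definitions (the witness is an explicit term).
-/

set_option linter.dupNamespace false

noncomputable section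

namespace Summit.ValiantsHypothesis.ValiantsHypothesis.Theorems.LiouvilleSarnakLiouvilleCutRank.MultiplicativeBarrier

open Finset

open Summit.ValiantsHypothesis.ValiantsHypothesis.Theorems.LiouvilleSarnakLiouvilleCutRank.OneBlock
  (rank_le_card_image_row)

/-! ### §1 The witness `f(2^v m') = (-1)^v χ₄(m')` on numbers `2^v · odd` -/

/-- The witness evaluated at `2^v · M`, `M` odd: `(-1)^v · χ₄(M)` with `χ₄(M) = -1` iff `M ≡ 3 (mod 4)`. [folklore] -/
theorem witness_two_pow_mul_odd (v M : ℕ) (hM : M % 2 = 1) :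
    (fun m : ℕ => (-1 : ℤ) ^ (m.factorization 2) * (if (m / 2 ^ (m.factorization 2)) % 4 = 3 then -1 else 1))
        (2 ^ v * M) =
      (-1 : ℤ) ^ v * (if M % 4 = 3 then -1 else 1) := by
  have hM0 : M ≠ 0 := by intro h; simp [h] at hM
  have hfac : (2 ^ v * M).factorization 2 = v := by
    rw [Nat.factorization_mul (pow_ne_zero _ two_ne_zero) hM0, Finsupp.add_apply,
      Nat.Prime.factorization_pow Nat.prime_two, Finsupp.single_eq_same,
      Nat.factorization_eq_zero_of_not_dvd (fun h => by omega), add_zero]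
  simp only [hfac, Nat.mul_div_cancel_left M (Nat.two_pow_pos v)]

/-- Every positive integer is `2^v · M` with `M` odd (`v = v₂(m)`, `M` the odd part). [folklore] -/
theorem exists_eq_two_pow_mul_odd (m : ℕ) (hm : m ≠ 0) :
    ∃ v M : ℕ, M % 2 = 1 ∧ m = 2 ^ v * M := by
  refine ⟨m.factorization 2, m / 2 ^ m.factorization 2, ?_, (Nat.ordProj_mul_ordCompl_eq_self m 2).symm⟩
  have h := Nat.not_dvd_ordCompl Nat.prime_two hm
  omega

/-- For odd `M₁, M₂`: `χ₄(M₁ M₂) = χ₄(M₁) χ₄(M₂)` in the `±1` form. [folklore] -/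
theorem sign_mul_of_odd (M₁ M₂ : ℕ) (h₁ : M₁ % 2 = 1) (h₂ : M₂ % 2 = 1) :
    (if (M₁ * M₂) % 4 = 3 then (-1 : ℤ) else 1) =
      (if M₁ % 4 = 3 then (-1 : ℤ) else 1) * (if M₂ % 4 = 3 then (-1 : ℤ) else 1) := by
  have hm : (M₁ * M₂) % 4 = ((M₁ % 4) * (M₂ % 4)) % 4 := Nat.mul_mod _ _ _
  have h1' : M₁ % 4 = 1 ∨ M₁ % 4 = 3 := by omega
  have h2' : M₂ % 4 = 1 ∨ M₂ % 4 = 3 := by omega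
  rcases h1' with ha | ha <;> rcases h2' with hb | hb <;> simp [hm, ha, hb]

/-! ### §2 The barrier -/

/-- ★ **Complete multiplicativity is not enough.**  There is a completely multiplicative `f : ℕ → ℤ` with values in
`{1, -1}` on the positive integers, with `f(2) = -1` and `f(m) = -1` for every `m ≡ 3 (mod 4)` (in particular
`f(3) = f(7) = -1 = λ(3) = λ(7)`, and `f(p) = λ(p)` for all primes `p ≡ 3 (mod 4)`), such that for every `n ≥ 2` the
aligned cut matrix `(f(a + 2^n b + 1))_{a,b<2^n}` has rank `≤ 4`.  Witness: `f(2^v M) = (-1)^v χ₄(M)` (`M` odd): the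
row `a` is the constant `f(a+1)` unless `2^{n-1} ∣ a+1`, so there are at most four distinct rows. [folklore] -/
theorem exists_completelyMultiplicative_alignedRank_le_four :
    ∃ f : ℕ → ℤ, (∀ m, 1 ≤ m → f m = 1 ∨ f m = -1) ∧ (∀ a b, 1 ≤ a → 1 ≤ b → f (a * b) = f a * f b) ∧
      f 2 = -1 ∧ (∀ m, m % 4 = 3 → f m = -1) ∧
      ∀ n, 2 ≤ n → (Matrix.of fun a b : Fin (2 ^ n) =>
        ((f ((a : ℕ) + 2 ^ n * (b : ℕ) + 1) : ℤ) : ℂ)).rank ≤ 4 := by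
  classical
  let f : ℕ → ℤ := fun m =>
    (-1 : ℤ) ^ (m.factorization 2) * (if (m / 2 ^ (m.factorization 2)) % 4 = 3 then -1 else 1)
  have hf : ∀ v M : ℕ, M % 2 = 1 → f (2 ^ v * M) = (-1 : ℤ) ^ v * (if M % 4 = 3 then -1 else 1) :=
    fun v M hM => witness_two_pow_mul_odd v M hM
  refine ⟨f, fun m hm => ?_, fun a b ha hb => ?_, ?_, fun m hm => ?_, fun n hn => ?_⟩
  · -- values `±1`
    obtain ⟨v, M, hM, rfl⟩ := exists_eq_two_pow_mul_odd m (by omega)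
    rw [hf v M hM]
    rcases neg_one_pow_eq_or ℤ v with h | h <;> rw [h] <;> split_ifs <;> simp
  · -- complete multiplicativity
    obtain ⟨v, M, hM, rfl⟩ := exists_eq_two_pow_mul_odd a (by omega)
    obtain ⟨v', M', hM', rfl⟩ := exists_eq_two_pow_mul_odd b (by omega)
    have hMM : (M * M') % 2 = 1 := by
      have := Nat.mul_mod M M' 2; rw [hM, hM'] at this; simpa using this
    rw [show 2 ^ v * M * (2 ^ v' * M') = 2 ^ (v + v') * (M * M') by ring, hf _ _ hMM, hf v M hM,
      hf v' M' hM', sign_mul_of_odd M M' hM hM', pow_add]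
    ring
  · -- `f 2 = -1`
    have := hf 1 1 (by norm_num)
    simpa using this
  · -- `f m = -1` for `m ≡ 3 (mod 4)`
    have h1 : m % 2 = 1 := by omega
    have := hf 0 m h1
    simp only [pow_zero, one_mul, hm, if_true] at this
    simpa using this
  · -- the aligned matrix has at most four distinct rows
    set A : Matrix (Fin (2 ^ n)) (Fin (2 ^ n)) ℂ := Matrix.of fun a b : Fin (2 ^ n) =>
        ((f ((a : ℕ) + 2 ^ n * (b : ℕ) + 1) : ℤ) : ℂ) with hA
    -- generic rows are constant
    have hconst : ∀ a : Fin (2 ^ n), ((a : ℕ) + 1).factorization 2 + 2 ≤ n →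
        A a = fun _ => ((f ((a : ℕ) + 1) : ℤ) : ℂ) := by
      intro a hv
      funext b
      simp only [hA, Matrix.of_apply]
      congr 1
      obtain ⟨v, M, hM, hm⟩ := exists_eq_two_pow_mul_odd ((a : ℕ) + 1) (Nat.succ_ne_zero _)
      have hvf : ((a : ℕ) + 1).factorization 2 = v := by
        rw [hm, Nat.factorization_mul (pow_ne_zero _ two_ne_zero) (by omega), Finsupp.add_apply,
          Nat.Prime.factorization_pow Nat.prime_two, Finsupp.single_eq_same,
          Nat.factorization_eq_zero_of_not_dvd (fun h => by omega), add_zero]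
      rw [hvf] at hv
      -- `a + 1 + 2^n b = 2^v (M + 4K)` with `K = 2^(n-v-2) b`: odd and `≡ M (mod 4)`
      have h2 : 2 ^ n = 2 ^ v * (2 ^ (n - v - 2) * 4) := by
        rw [show (4 : ℕ) = 2 ^ 2 by norm_num, ← pow_add, ← pow_add]; congr 1; omega
      have h3 : 2 ^ n * (b : ℕ) = 2 ^ v * (2 ^ (n - v - 2) * 4) * (b : ℕ) := by rw [← h2]
      set K : ℕ := 2 ^ (n - v - 2) * (b : ℕ) with hK
      have hsplit : (a : ℕ) + 2 ^ n * (b : ℕ) + 1 = 2 ^ v * (M + 4 * K) := by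
        calc (a : ℕ) + 2 ^ n * (b : ℕ) + 1 = ((a : ℕ) + 1) + 2 ^ n * (b : ℕ) := by ring
          _ = 2 ^ v * M + 2 ^ v * (2 ^ (n - v - 2) * 4) * (b : ℕ) := by rw [hm, h3]
          _ = 2 ^ v * (M + 4 * K) := by rw [hK]; ring
      have hodd : (M + 4 * K) % 2 = 1 := by omega
      have hmod : (M + 4 * K) % 4 = M % 4 := by omega
      rw [hsplit, hf _ _ hodd, hm, hf v M hM, hmod]
    -- the exceptional rows: `2^(n-1) ∣ a + 1`, i.e. `a + 1 ∈ {2^(n-1), 2^n}`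
    have hexc : ∀ a : Fin (2 ^ n), ¬ ((a : ℕ) + 1).factorization 2 + 2 ≤ n →
        (a : ℕ) + 1 = 2 ^ (n - 1) ∨ (a : ℕ) + 1 = 2 ^ n := by
      intro a hv
      have hdvd : 2 ^ (n - 1) ∣ (a : ℕ) + 1 := by
        have h1 : 2 ^ (((a : ℕ) + 1).factorization 2) ∣ (a : ℕ) + 1 := Nat.ordProj_dvd _ _
        exact dvd_trans (pow_dvd_pow 2 (by omega)) h1
      obtain ⟨k, hk⟩ := hdvd
      have ha : (a : ℕ) < 2 ^ n := a.isLt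
      have h2n : 2 ^ n = 2 * 2 ^ (n - 1) := by
        rw [← pow_succ']; congr 1; omega
      have hc : 1 ≤ 2 ^ (n - 1) := Nat.one_le_two_pow
      have hkpos : 1 ≤ k := by
        rcases Nat.eq_zero_or_pos k with h0 | h0
        · simp [h0] at hk
        · exact h0
      have hk2 : k ≤ 2 := by
        by_contra h3
        have h3' : 3 ≤ k := by omega
        have : 2 ^ (n - 1) * 3 ≤ 2 ^ (n - 1) * k := Nat.mul_le_mul_left _ h3'
        omega
      interval_cases k
      · left; omega
      · right; omega
    have h2n1 : 2 ^ (n - 1) - 1 < 2 ^ n := by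
      have : 2 ^ (n - 1) ≤ 2 ^ n := Nat.pow_le_pow_right (by norm_num) (by omega)
      have : 1 ≤ 2 ^ (n - 1) := Nat.one_le_two_pow
      omega
    have h2n2 : 2 ^ n - 1 < 2 ^ n := Nat.sub_lt (Nat.two_pow_pos n) Nat.one_pos
    set a₁ : Fin (2 ^ n) := ⟨2 ^ (n - 1) - 1, h2n1⟩ with ha₁
    set a₂ : Fin (2 ^ n) := ⟨2 ^ n - 1, h2n2⟩ with ha₂
    have himage : (Finset.univ.image fun a : Fin (2 ^ n) => A a) ⊆
        {(fun _ => (1 : ℂ)), (fun _ => (-1 : ℂ)), A a₁, A a₂} := by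
      intro x hx
      rw [Finset.mem_image] at hx
      obtain ⟨a, -, rfl⟩ := hx
      simp only [Finset.mem_insert, Finset.mem_singleton]
      by_cases hv : ((a : ℕ) + 1).factorization 2 + 2 ≤ n
      · rw [hconst a hv]
        obtain ⟨v, M, hM, hm⟩ := exists_eq_two_pow_mul_odd ((a : ℕ) + 1) (Nat.succ_ne_zero _)
        rw [hm, hf v M hM]
        rcases neg_one_pow_eq_or ℤ v with h | h <;> rw [h] <;> split_ifs <;> simp
      · rcases hexc a hv with h | h
        · right; right; left
          have : a = a₁ := by rw [ha₁]; ext; simp; omega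
          rw [this]
        · right; right; right
          have : a = a₂ := by rw [ha₂]; ext; simp; omega
          rw [this]
    calc A.rank ≤ (Finset.univ.image fun a : Fin (2 ^ n) => A a).card := rank_le_card_image_row A
      _ ≤ ({(fun _ => (1 : ℂ)), (fun _ => (-1 : ℂ)), A a₁, A a₂} : Finset (Fin (2 ^ n) → ℂ)).card :=
          Finset.card_le_card himage
      _ ≤ 4 := by
          refine (Finset.card_insert_le _ _).trans ?_
          refine (Nat.succ_le_succ (Finset.card_insert_le _ _)).trans ?_
          refine (Nat.succ_le_succ (Nat.succ_le_succ (Finset.card_insert_le _ _))).trans ?_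
          simp

end Summit.ValiantsHypothesis.ValiantsHypothesis.Theorems.LiouvilleSarnakLiouvilleCutRank.MultiplicativeBarrier
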